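import Mathlib

/-!
# Positivity algebra for cyclic triple sums of real arrays

Helper file (pure real inequalities, no group theory) for the LEVEL-ONE programme on the crux
`SnSubsetDichotomy.PolynomialSlack` (stmt-MatrixMultiplication-8306; idea card
`deficit-budget-positivity`, "NEGATIVITY NEEDS DEFICITS"). For real `n × n` arrays `P, Q, R` with Frobenius norms
`‖X‖ = √(Σ X²)` and negative parts `X⁻ = max(0, -X)`:

* `tripleSum_le_norms` — `Σ_{i,j,k} P_{ij}Q_{jk}R_{ki} ≤ ‖P‖‖Q‖‖R‖` (Cauchy–Schwarz twice);
* `neg_tripleSum_le` — **`-Σ_{i,j,k} P_{ij}Q_{jk}R_{ki} ≤ ‖P‖‖Q‖‖R⁻‖ + ‖P‖‖Q⁻‖‖R‖ + ‖P⁻‖‖Q‖‖R‖`**: a negative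
  cyclic correlation must be paid for by the negative part of one of the three arrays
  (pointwise `abc ≥ -(|a||b|c⁻ + |a|b⁻|c| + a⁻|b||c|)`);
* `centered_tripleSum_eq`, `sumSq_centered_eq` — for arrays with unit row and column sums (doubly
  stochastic up to scaling), centring at `1/n` changes the cyclic triple sum by exactly `-1` and the sum
  of squares by exactly `-1`: `Σ(a-1/n)(b-1/n)(c-1/n) = Σabc - 1`, `Σ(a-1/n)² = Σa² - 1`.
-/

namespace Summit.MatrixMultiplication.MatrixMultiplication.Theorems.PolynomialSlack

open scoped BigOperators

-- `Summit.<Summit>.<Problem>` is the tree's mandated summit-side namespace (CONVENTIONS §2); for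
-- this single-conjunct summit the two coincide, so each declaration silences `dupNamespace`.
set_option linter.dupNamespace false

variable {n : ℕ}

/-! ## Cauchy–Schwarz for double and cyclic triple sums -/

/-- Cauchy–Schwarz for double sums: `Σ_{i,k} f g ≤ √(Σ f²)·√(Σ g²)`. [folklore] -/
theorem doubleSum_mul_le_sqrt (f g : Fin n → Fin n → ℝ) :
    ∑ i : Fin n, ∑ k : Fin n, f i k * g i k ≤
      Real.sqrt (∑ i : Fin n, ∑ k : Fin n, f i k ^ 2) * Real.sqrt (∑ i : Fin n, ∑ k : Fin n, g i k ^ 2) := by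
  have h := Finset.sum_mul_sq_le_sq_mul_sq Finset.univ (fun p : Fin n × Fin n => f p.1 p.2)
    (fun p : Fin n × Fin n => g p.1 p.2)
  simp only [Fintype.sum_prod_type] at h
  have hf : 0 ≤ ∑ i : Fin n, ∑ k : Fin n, f i k ^ 2 :=
    Finset.sum_nonneg fun _ _ => Finset.sum_nonneg fun _ _ => sq_nonneg _
  have hg : 0 ≤ ∑ i : Fin n, ∑ k : Fin n, g i k ^ 2 :=
    Finset.sum_nonneg fun _ _ => Finset.sum_nonneg fun _ _ => sq_nonneg _
  calc ∑ i : Fin n, ∑ k : Fin n, f i k * g i k ≤ |∑ i : Fin n, ∑ k : Fin n, f i k * g i k| := le_abs_self _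
    _ = Real.sqrt ((∑ i : Fin n, ∑ k : Fin n, f i k * g i k) ^ 2) := (Real.sqrt_sq_eq_abs _).symm
    _ ≤ Real.sqrt ((∑ i : Fin n, ∑ k : Fin n, f i k ^ 2) * ∑ i : Fin n, ∑ k : Fin n, g i k ^ 2) :=
        Real.sqrt_le_sqrt h
    _ = _ := Real.sqrt_mul hf _

/-- **`Σ_{i,j,k} P_{ij}Q_{jk}R_{ki} ≤ ‖P‖‖Q‖‖R‖`** (Frobenius norms). [folklore] -/
theorem tripleSum_le_norms (P Q R : Fin n → Fin n → ℝ) :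
    ∑ i : Fin n, ∑ j : Fin n, ∑ k : Fin n, P i j * Q j k * R k i ≤
      Real.sqrt (∑ i : Fin n, ∑ j : Fin n, P i j ^ 2) * Real.sqrt (∑ j : Fin n, ∑ k : Fin n, Q j k ^ 2) *
        Real.sqrt (∑ k : Fin n, ∑ i : Fin n, R k i ^ 2) := by
  -- `X_{ik} = Σ_j P_{ij} Q_{jk}`
  set X : Fin n → Fin n → ℝ := fun i k => ∑ j : Fin n, P i j * Q j k with hX
  have h1 : ∑ i : Fin n, ∑ j : Fin n, ∑ k : Fin n, P i j * Q j k * R k i =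
      ∑ i : Fin n, ∑ k : Fin n, X i k * R k i := by
    refine Finset.sum_congr rfl fun i _ => ?_
    rw [Finset.sum_comm]
    refine Finset.sum_congr rfl fun k _ => ?_
    rw [hX, Finset.sum_mul]
  rw [h1]
  -- Cauchy–Schwarz in `(i,k)`
  have h2 := doubleSum_mul_le_sqrt X (fun i k => R k i)
  -- `Σ X² ≤ (Σ P²)(Σ Q²)`
  have h3 : ∑ i : Fin n, ∑ k : Fin n, X i k ^ 2 ≤
      (∑ i : Fin n, ∑ j : Fin n, P i j ^ 2) * ∑ j : Fin n, ∑ k : Fin n, Q j k ^ 2 := by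
    have hik : ∀ i k, X i k ^ 2 ≤ (∑ j : Fin n, P i j ^ 2) * ∑ j : Fin n, Q j k ^ 2 := fun i k =>
      Finset.sum_mul_sq_le_sq_mul_sq Finset.univ (fun j => P i j) (fun j => Q j k)
    calc ∑ i : Fin n, ∑ k : Fin n, X i k ^ 2
        ≤ ∑ i : Fin n, ∑ k : Fin n, (∑ j : Fin n, P i j ^ 2) * ∑ j : Fin n, Q j k ^ 2 :=
          Finset.sum_le_sum fun i _ => Finset.sum_le_sum fun k _ => hik i k
      _ = (∑ i : Fin n, ∑ j : Fin n, P i j ^ 2) * ∑ k : Fin n, ∑ j : Fin n, Q j k ^ 2 := by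
          rw [Finset.sum_mul_sum]
      _ = (∑ i : Fin n, ∑ j : Fin n, P i j ^ 2) * ∑ j : Fin n, ∑ k : Fin n, Q j k ^ 2 := by
          rw [Finset.sum_comm (f := fun k j => Q j k ^ 2)]
  have hP : 0 ≤ ∑ i : Fin n, ∑ j : Fin n, P i j ^ 2 :=
    Finset.sum_nonneg fun _ _ => Finset.sum_nonneg fun _ _ => sq_nonneg _
  have hR : Real.sqrt (∑ i : Fin n, ∑ k : Fin n, R k i ^ 2) = Real.sqrt (∑ k : Fin n, ∑ i : Fin n, R k i ^ 2) := by
    rw [Finset.sum_comm]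
  calc ∑ i : Fin n, ∑ k : Fin n, X i k * R k i
      ≤ Real.sqrt (∑ i : Fin n, ∑ k : Fin n, X i k ^ 2) * Real.sqrt (∑ i : Fin n, ∑ k : Fin n, R k i ^ 2) := h2
    _ ≤ Real.sqrt ((∑ i : Fin n, ∑ j : Fin n, P i j ^ 2) * ∑ j : Fin n, ∑ k : Fin n, Q j k ^ 2) *
          Real.sqrt (∑ i : Fin n, ∑ k : Fin n, R k i ^ 2) :=
        mul_le_mul_of_nonneg_right (Real.sqrt_le_sqrt h3) (Real.sqrt_nonneg _)
    _ = _ := by rw [Real.sqrt_mul hP, hR]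

/-! ## Negativity needs negative parts -/

/-- Pointwise: `abc ≥ -(|a||b|c⁻ + |a|b⁻|c| + a⁻|b||c|)`. [folklore] -/
theorem neg_parts_le_mul_three (a b c : ℝ) :
    -(|a| * |b| * max 0 (-c) + |a| * max 0 (-b) * |c| + max 0 (-a) * |b| * |c|) ≤ a * b * c := by
  have h1 : 0 ≤ |a| * |b| * max 0 (-c) := by positivity
  have h2 : 0 ≤ |a| * max 0 (-b) * |c| := by positivity
  have h3 : 0 ≤ max 0 (-a) * |b| * |c| := by positivity
  rcases lt_or_ge c 0 with hc | hc
  · have hmc : max 0 (-c) = -c := max_eq_right (by linarith)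
    have hab : a * b ≤ |a| * |b| := by rw [← abs_mul]; exact le_abs_self _
    have key : |a| * |b| * c ≤ a * b * c := by
      nlinarith [mul_nonneg (sub_nonneg.2 hab) (neg_nonneg.2 hc.le)]
    rw [hmc]
    linarith
  · have hmc0 : max 0 (-c) = 0 := max_eq_left (by linarith)
    rcases lt_or_ge b 0 with hb | hb
    · have hmb : max 0 (-b) = -b := max_eq_right (by linarith)
      have hcc : |c| = c := abs_of_nonneg hc
      have ha : a ≤ |a| := le_abs_self a
      have hbc : b * c ≤ 0 := mul_nonpos_of_nonpos_of_nonneg hb.le hc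
      have key : |a| * b * c ≤ a * b * c := by
        nlinarith [mul_nonneg_of_nonpos_of_nonpos hbc (sub_nonpos.2 ha)]
      have h3' : 0 ≤ max 0 (-a) * |b| * c := mul_nonneg (mul_nonneg (le_max_left _ _) (abs_nonneg _)) hc
      rw [hmc0, hmb, hcc]
      linarith
    · have hmb0 : max 0 (-b) = 0 := max_eq_left (by linarith)
      rcases lt_or_ge a 0 with ha | ha
      · have hma : max 0 (-a) = -a := max_eq_right (by linarith)
        have hbb : |b| = b := abs_of_nonneg hb
        have hcc : |c| = c := abs_of_nonneg hc
        rw [hmc0, hmb0, hma, hbb, hcc]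
        linarith
      · have : 0 ≤ a * b * c := by positivity
        linarith

/-- `Σ |X|² = Σ X²`. [folklore] -/
theorem sumSq_abs (X : Fin n → Fin n → ℝ) :
    ∑ i : Fin n, ∑ j : Fin n, |X i j| ^ 2 = ∑ i : Fin n, ∑ j : Fin n, X i j ^ 2 := by
  simp_rw [sq_abs]

/-- **Negativity needs deficits**: `-Σ_{i,j,k} P_{ij}Q_{jk}R_{ki} ≤ ‖P‖‖Q‖‖R⁻‖ + ‖P‖‖Q⁻‖‖R‖ + ‖P⁻‖‖Q‖‖R‖`
with `‖X‖ = √(Σ X²)` and `X⁻ = max(0,-X)` entrywise. [folklore] -/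
theorem neg_tripleSum_le (P Q R : Fin n → Fin n → ℝ) :
    -(∑ i : Fin n, ∑ j : Fin n, ∑ k : Fin n, P i j * Q j k * R k i) ≤
      Real.sqrt (∑ i : Fin n, ∑ j : Fin n, P i j ^ 2) * Real.sqrt (∑ j : Fin n, ∑ k : Fin n, Q j k ^ 2) *
          Real.sqrt (∑ k : Fin n, ∑ i : Fin n, (max 0 (-R k i)) ^ 2) +
        Real.sqrt (∑ i : Fin n, ∑ j : Fin n, P i j ^ 2) *
            Real.sqrt (∑ j : Fin n, ∑ k : Fin n, (max 0 (-Q j k)) ^ 2) *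
          Real.sqrt (∑ k : Fin n, ∑ i : Fin n, R k i ^ 2) +
        Real.sqrt (∑ i : Fin n, ∑ j : Fin n, (max 0 (-P i j)) ^ 2) *
            Real.sqrt (∑ j : Fin n, ∑ k : Fin n, Q j k ^ 2) *
          Real.sqrt (∑ k : Fin n, ∑ i : Fin n, R k i ^ 2) := by
  -- pointwise bound, summed
  have hpt : -(∑ i : Fin n, ∑ j : Fin n, ∑ k : Fin n, P i j * Q j k * R k i) ≤
      (∑ i : Fin n, ∑ j : Fin n, ∑ k : Fin n, |P i j| * |Q j k| * max 0 (-R k i)) +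
        (∑ i : Fin n, ∑ j : Fin n, ∑ k : Fin n, |P i j| * max 0 (-Q j k) * |R k i|) +
        (∑ i : Fin n, ∑ j : Fin n, ∑ k : Fin n, max 0 (-P i j) * |Q j k| * |R k i|) := by
    rw [← Finset.sum_add_distrib, ← Finset.sum_add_distrib, ← Finset.sum_neg_distrib]
    refine Finset.sum_le_sum fun i _ => ?_
    rw [← Finset.sum_add_distrib, ← Finset.sum_add_distrib, ← Finset.sum_neg_distrib]
    refine Finset.sum_le_sum fun j _ => ?_
    rw [← Finset.sum_add_distrib, ← Finset.sum_add_distrib, ← Finset.sum_neg_distrib]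
    refine Finset.sum_le_sum fun k _ => ?_
    have := neg_parts_le_mul_three (P i j) (Q j k) (R k i)
    linarith
  -- each of the three sums is a cyclic triple sum, bounded by the norms
  have t1 := tripleSum_le_norms (fun i j => |P i j|) (fun j k => |Q j k|) (fun k i => max 0 (-R k i))
  have t2 := tripleSum_le_norms (fun i j => |P i j|) (fun j k => max 0 (-Q j k)) (fun k i => |R k i|)
  have t3 := tripleSum_le_norms (fun i j => max 0 (-P i j)) (fun j k => |Q j k|) (fun k i => |R k i|)
  simp only [sumSq_abs] at t1 t2 t3
  have eQ : Real.sqrt (∑ i : Fin n, ∑ j : Fin n, Q i j ^ 2) = Real.sqrt (∑ j : Fin n, ∑ k : Fin n, Q j k ^ 2) := rfl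
  have eR : Real.sqrt (∑ i : Fin n, ∑ j : Fin n, R i j ^ 2) = Real.sqrt (∑ k : Fin n, ∑ i : Fin n, R k i ^ 2) := rfl
  rw [eQ] at t1 t3
  rw [eR] at t2 t3
  linarith

/-! ## Centring arrays with unit row and column sums -/

/-- For an array with unit row sums, `Σ_{i,j}(a - 1/n)² = Σ a² - 1` (needs `Σ_{i,j} a = n`). [folklore] -/
theorem sumSq_centered_eq (hn : n ≠ 0) (a : Fin n → Fin n → ℝ) (har : ∀ i, ∑ j : Fin n, a i j = 1) :
    ∑ i : Fin n, ∑ j : Fin n, (a i j - 1 / n) ^ 2 = ∑ i : Fin n, ∑ j : Fin n, a i j ^ 2 - 1 := by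
  have hnR : (n : ℝ) ≠ 0 := by exact_mod_cast hn
  have hrow : ∀ i, ∑ j : Fin n, (a i j - 1 / n) ^ 2 = ∑ j : Fin n, a i j ^ 2 - 2 / n + 1 / n := by
    intro i
    have hexp : ∀ j, (a i j - 1 / n) ^ 2 = a i j ^ 2 - 2 / n * a i j + 1 / n ^ 2 := fun j => by ring
    rw [Finset.sum_congr rfl fun j _ => hexp j, Finset.sum_add_distrib, Finset.sum_sub_distrib,
      ← Finset.mul_sum, har i, Finset.sum_const, Finset.card_univ, Fintype.card_fin, nsmul_eq_mul]
    field_simp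
  rw [Finset.sum_congr rfl fun i _ => hrow i, Finset.sum_add_distrib, Finset.sum_sub_distrib,
    Finset.sum_const, Finset.sum_const, Finset.card_univ, Fintype.card_fin, nsmul_eq_mul, nsmul_eq_mul]
  field_simp
  ring

/-- **Centring a cyclic triple sum**: for arrays `a, b, c` with unit row and column sums,
`Σ_{i,j,k}(a_{ij} - 1/n)(b_{jk} - 1/n)(c_{ki} - 1/n) = Σ_{i,j,k} a_{ij}b_{jk}c_{ki} - 1`. [folklore] -/
theorem centered_tripleSum_eq (hn : n ≠ 0) (a b c : Fin n → Fin n → ℝ)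
    (har : ∀ i, ∑ j : Fin n, a i j = 1) (hbr : ∀ j, ∑ k : Fin n, b j k = 1)
    (hbc : ∀ k, ∑ j : Fin n, b j k = 1) (hcr : ∀ k, ∑ i : Fin n, c k i = 1)
    (hcc : ∀ i, ∑ k : Fin n, c k i = 1) :
    ∑ i : Fin n, ∑ j : Fin n, ∑ k : Fin n, (a i j - 1 / n) * (b j k - 1 / n) * (c k i - 1 / n) =
      ∑ i : Fin n, ∑ j : Fin n, ∑ k : Fin n, a i j * b j k * c k i - 1 := by
  have hnR : (n : ℝ) ≠ 0 := by exact_mod_cast hn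
  -- the seven auxiliary sums
  have hn2 : ∀ f : Fin n → ℝ, (∀ i, f i = 1) → ∑ i : Fin n, f i = n := fun f hf => by
    rw [Finset.sum_congr rfl fun i _ => hf i]; simp
  have e1 : ∑ i : Fin n, ∑ j : Fin n, a i j * ∑ k : Fin n, b j k = n := by
    rw [Finset.sum_congr rfl fun i _ => Finset.sum_congr rfl fun j _ => by
      rw [hbr j, mul_one]]
    exact hn2 _ har
  have e2 : ∑ i : Fin n, ∑ j : Fin n, a i j * ∑ k : Fin n, c k i = n := by
    rw [Finset.sum_congr rfl fun i _ => Finset.sum_congr rfl fun j _ => by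
      rw [hcc i, mul_one]]
    exact hn2 _ har
  have e3 : ∑ i : Fin n, ∑ j : Fin n, ∑ k : Fin n, b j k * c k i = n := by
    rw [Finset.sum_comm]
    rw [Finset.sum_congr rfl fun j _ => by rw [Finset.sum_comm]]
    rw [Finset.sum_comm]
    rw [Finset.sum_congr rfl fun k _ => Finset.sum_congr rfl fun j _ => by rw [← Finset.mul_sum, hcr k, mul_one]]
    exact hn2 _ hbc
  have hconst : ∀ x : ℝ, ∑ _i : Fin n, x = n * x := fun x => by simp
  have e4 : ∑ i : Fin n, ∑ j : Fin n, ∑ k : Fin n, a i j = n * n := by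
    rw [Finset.sum_congr rfl fun i _ => Finset.sum_congr rfl fun j _ => hconst (a i j)]
    rw [Finset.sum_congr rfl fun i _ => by rw [← Finset.mul_sum, har i, mul_one], hconst]
  have e5 : ∑ i : Fin n, ∑ j : Fin n, ∑ k : Fin n, b j k = n * n := by
    rw [Finset.sum_congr rfl fun i _ => Finset.sum_congr rfl fun j _ => hbr j, hconst, hconst, mul_one]
  have e6 : ∑ i : Fin n, ∑ j : Fin n, ∑ k : Fin n, c k i = n * n := by
    rw [Finset.sum_congr rfl fun i _ => Finset.sum_congr rfl fun j _ => hcc i, hconst, hconst, mul_one]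
  have e7 : ∑ i : Fin n, ∑ j : Fin n, ∑ k : Fin n, (1 : ℝ) = n * n * n := by
    rw [hconst, hconst, hconst]; ring
  -- expand the summand and distribute
  have hexp : ∀ i j k, (a i j - 1 / n) * (b j k - 1 / n) * (c k i - 1 / n) =
      a i j * b j k * c k i - 1 / n * (a i j * b j k) - 1 / n * (a i j * c k i) - 1 / n * (b j k * c k i) +
        1 / n ^ 2 * a i j + 1 / n ^ 2 * b j k + 1 / n ^ 2 * c k i - 1 / n ^ 3 * 1 := by
    intro i j k; ring
  simp_rw [hexp]
  simp only [Finset.sum_add_distrib, Finset.sum_sub_distrib, ← Finset.mul_sum]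
  rw [e1, e2, e3, e4, e5, e6, e7]
  field_simp
  ring

end Summit.MatrixMultiplication.MatrixMultiplication.Theorems.PolynomialSlack
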